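import Mathlib
import Summits.ValiantsHypothesis.ValiantsHypothesis.Theorems.GrenetZeonTwoDimCoefficientsScalingRankOneCoupling
import Summits.ValiantsHypothesis.ValiantsHypothesis.Theorems.GrenetZeonTwoDimCoefficientsScalingLowRankCoupling

/-!
# Crux `GrenetZeon.TwoDimCoefficients` (stmt-ValiantsHypothesis-8062) / rung `DualUnipotentThreeHalves` (stmt-24318):
# scaling-closure — the coupling ⟷ back-coupling symmetry IN THE LEDGER'S OWN (level) LANGUAGE; rank-one couplings priced

✓ `…ScalingCouplingSwap` (p839184) proves the two-level symmetry of the cut term for explicit block data.  The ledger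
(✓ `sq_sub_rank_mul_le_of_levelCut`) speaks of ONE pencil `N : AffMat n m` with a labelling `lvl`; this file redoes the
symmetry basis-free, so that it plugs into the ledger verbatim.  For a TWO-level labelling (`lvl a ≤ 1`) split
`N = D + Ĉ` (`D` = same-level entries, `Ĉ` = entries from the upper level down — the coupling) and let `M̂ = M^cut` (entries
from the lower level up).  Then `Ĉ·D^j·Ĉ = 0 = M̂·D^j·M̂`, `tr(D^k·M̂) = 0 = tr(D^k·Ĉ)`, and

  `tr(N^k·M̂) = Σ_{i<k} tr(D^i·Ĉ·D^{k−1−i}·M̂) = tr((D + M̂)^k·Ĉ)`   (`trace_pow_mul_cut_eq_swap`):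

the pencil `N' = D + M̂` (the cut part moved INTO the pencil) against the numerator `Ĉ` (the coupling moved OUT) has the same
cut term and the same companions.  `N'` is again linear and nilpotent (`D^m = 0` because `N^m = 0`: the block-diagonal part of
the expansion of `N^m`).  Hence ✓ `rank_hess0_trace_pow_vecMulVec_le` / `…le'` price a RANK-ONE COUPLING `Ĉ = u vᵀ`:

* ★ `rank_hess0_cut_le_of_rankOne_coupling_lvl` — `rank Hess_z tr(N^{n−1}·M^cut) ≤ 2(m+1)` (u constant, v linear; any `M`),
  under the high constraints `tr(N^k·M^cut) = 0`, `k ≥ n` (✓ `trace_pow_mul_cut_eq_zero_of_classIndex`);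
* ★ `sq_sub_mul_le_of_levelCut_rankOneCoupling` — ledger form: two-level `N` with index-`n` classes and a rank-one coupling block
  obeys `(n² − 2(m+1))·n ≤ 2·Σ_p s_p²`, WHATEVER the back-coupling.

Generic algebra: `add_pow_eq_of_mul_pow_mul_eq_zero` (`(D+E)^k = D^k + Σ D^i E D^{k−1−i}` when `E D^j E = 0`) and
`trace_add_pow_mul_swap`.

HONEST FRAMING: bookkeeping + a thin priced class; (P3′) (full-rank constrained cut term), `DualUnipotentBound`, crux 8062, the 24318
decl and `VP ≠ VNP` remain open.

References: T. Mignon, N. Ressayre, Int. Math. Res. Not. 2004:79, Thm. 1.1 (via the tree); folklore.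
-/

-- single-conjunct layout `Summits/ValiantsHypothesis/ValiantsHypothesis`: the duplicated namespace
-- component is mandated by the tree.
set_option linter.dupNamespace false
set_option autoImplicit false

noncomputable section

namespace Summit.ValiantsHypothesis.ValiantsHypothesis.Theorems.GrenetZeonTwoDimCoefficients.ScalingClosure

open MvPolynomial Matrix
open Literature.Computability.AlgebraicComplexity
open Summit.ValiantsHypothesis.ValiantsHypothesis.Cruxes.TwoDimCoefficients.DimTwoCases
open Summit.ValiantsHypothesis.ValiantsHypothesis.Theorems.GrenetZeon.SlowCore

section GenericSwap

variable {R : Type*} [CommRing R] {ι : Type*} [Fintype ι] [DecidableEq ι]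

/-- **Expansion with a square-zero-type perturbation**: if `E·D^j·E = 0` for all `j`, then
`(D + E)^k = D^k + Σ_{i<k} D^i·E·D^{k−1−i}`. [folklore] -/
theorem add_pow_eq_of_mul_pow_mul_eq_zero (D E : Matrix ι ι R) (hE : ∀ j, E * D ^ j * E = 0) :
    ∀ k : ℕ, (D + E) ^ k = D ^ k + ∑ i ∈ Finset.range k, D ^ i * E * D ^ (k - 1 - i) := by
  intro k
  induction k with
  | zero => rw [pow_zero, pow_zero, Finset.range_zero, Finset.sum_empty, add_zero]
  | succ k ih =>
    rw [pow_succ, ih, Matrix.add_mul, Matrix.mul_add, Matrix.mul_add, ← pow_succ, Matrix.sum_mul, Matrix.sum_mul]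
    -- the `E…E` terms vanish
    have hEE : ∑ i ∈ Finset.range k, D ^ i * E * D ^ (k - 1 - i) * E = 0 := by
      refine Finset.sum_eq_zero fun i _ => ?_
      rw [Matrix.mul_assoc (D ^ i), Matrix.mul_assoc (D ^ i), hE, Matrix.mul_zero]
    rw [hEE, add_zero, add_assoc]
    congr 1
    rw [Finset.sum_range_succ, show k + 1 - 1 - k = 0 by omega, pow_zero, Matrix.mul_one, add_comm]
    congr 1
    refine Finset.sum_congr rfl fun i hi => ?_
    rw [Finset.mem_range] at hi
    rw [Matrix.mul_assoc, ← pow_succ, show k + 1 - 1 - i = k - 1 - i + 1 by omega]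

/-- **Swap symmetry of the cut trace.**  If `E·D^j·E = 0 = F·D^j·F` and `tr(D^k·E) = 0 = tr(D^k·F)` for all exponents, then
`tr((D + E)^k·F) = tr((D + F)^k·E)`. [folklore] -/
theorem trace_add_pow_mul_swap (D E F : Matrix ι ι R) (hE : ∀ j, E * D ^ j * E = 0) (hF : ∀ j, F * D ^ j * F = 0)
    (htE : ∀ j, (D ^ j * E).trace = 0) (htF : ∀ j, (D ^ j * F).trace = 0) (k : ℕ) :
    ((D + E) ^ k * F).trace = ((D + F) ^ k * E).trace := by
  rw [add_pow_eq_of_mul_pow_mul_eq_zero D E hE k, add_pow_eq_of_mul_pow_mul_eq_zero D F hF k, Matrix.add_mul,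
    Matrix.add_mul, Matrix.trace_add, Matrix.trace_add, htE, htF, zero_add, zero_add, Matrix.sum_mul, Matrix.sum_mul,
    Matrix.trace_sum, Matrix.trace_sum, ← Finset.sum_range_reflect]
  refine Finset.sum_congr rfl fun i hi => ?_
  rw [Finset.mem_range] at hi
  rw [show k - 1 - (k - 1 - i) = i by omega, Matrix.mul_assoc (D ^ (k - 1 - i) * E) (D ^ i) F,
    Matrix.trace_mul_comm, ← Matrix.mul_assoc]

end GenericSwap

section TwoLevel

variable {n m : ℕ}

/-- Two-level split of a level-cut pencil: `N = D + Ĉ` (same-level part plus coupling). [folklore] -/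
theorem eq_diagPart_add_coupling (lvl : Fin m → ℕ) (N : AffMat n m) (hcut : ∀ a b, lvl a < lvl b → N a b = 0) :
    N = Matrix.of (fun a b : Fin m => if lvl a = lvl b then N a b else 0) +
      Matrix.of (fun a b : Fin m => if lvl b < lvl a then N a b else 0) := by
  refine Matrix.ext fun a b => ?_
  rw [Matrix.add_apply, Matrix.of_apply, Matrix.of_apply]
  rcases lt_trichotomy (lvl a) (lvl b) with h | h | h
  · rw [if_neg (ne_of_lt h), if_neg (lt_asymm h), add_zero, hcut a b h]
  · rw [if_pos h, if_neg (by rw [h]; exact lt_irrefl _), add_zero]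
  · rw [if_neg (ne_of_gt h), if_pos h, zero_add]

/-- With two levels, an up-entry matrix times a level-preserving power times an up-entry matrix vanishes; same for down. -/
theorem strict_mul_pow_diag_mul_strict_eq_zero (lvl : Fin m → ℕ) (hlvl : ∀ a, lvl a ≤ 1)
    (D E : AffMat n m) (hD : ∀ a b, lvl a ≠ lvl b → D a b = 0)
    (rel : Fin m → Fin m → Prop) (hrel : ∀ a b, rel a b → lvl b < lvl a)
    (hErel : ∀ a b, ¬ rel a b → E a b = 0) (j : ℕ) : E * D ^ j * E = 0 := by
  refine Matrix.ext fun a b => ?_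
  rw [Matrix.zero_apply, Matrix.mul_apply]
  refine Finset.sum_eq_zero fun d _ => ?_
  rw [Matrix.mul_apply]
  by_cases hdb : rel d b
  · have h1 := hrel d b hdb
    have hsum : ∑ c, E a c * (D ^ j) c d = 0 := by
      refine Finset.sum_eq_zero fun c _ => ?_
      by_cases hac : rel a c
      · have h2 := hrel a c hac
        have hcd : lvl c ≠ lvl d := by have := hlvl a; have := hlvl d; omega
        rw [pow_apply_eq_zero_of_lvl_ne lvl D hD j c d hcd, mul_zero]
      · rw [hErel a c hac, zero_mul]
    rw [hsum, zero_mul]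
  · rw [hErel d b hdb, mul_zero]

/-- A level-preserving power against an off-level matrix has trace zero. [folklore] -/
theorem trace_pow_diag_mul_offLevel_eq_zero (lvl : Fin m → ℕ) (D E : AffMat n m) (hD : ∀ a b, lvl a ≠ lvl b → D a b = 0)
    (hE : ∀ a b, lvl a = lvl b → E a b = 0) (j : ℕ) : (D ^ j * E).trace = 0 := by
  rw [Matrix.trace]
  refine Finset.sum_eq_zero fun a _ => ?_
  rw [Matrix.diag_apply, Matrix.mul_apply]
  refine Finset.sum_eq_zero fun b _ => ?_
  by_cases hab : lvl a = lvl b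
  · rw [hE b a hab.symm, mul_zero]
  · rw [pow_apply_eq_zero_of_lvl_ne lvl D hD j a b hab, zero_mul]

/-- ★ **The cut term in swapped form (two levels).**  `tr(N^k·M^cut) = tr((D + M^cut)^k·Ĉ)`, with `D` the same-level part and
`Ĉ` the coupling part of the level-cut pencil `N`. [folklore] -/
theorem trace_pow_mul_cut_eq_swap (lvl : Fin m → ℕ) (hlvl : ∀ a, lvl a ≤ 1) (N M : AffMat n m)
    (hcut : ∀ a b, lvl a < lvl b → N a b = 0) (k : ℕ) :
    (N ^ k * Matrix.of (fun i j : Fin m => if lvl i < lvl j then M i j else 0)).trace =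
      ((Matrix.of (fun a b : Fin m => if lvl a = lvl b then N a b else 0) +
          Matrix.of (fun i j : Fin m => if lvl i < lvl j then M i j else 0)) ^ k *
        Matrix.of (fun a b : Fin m => if lvl b < lvl a then N a b else 0)).trace := by
  have hD : ∀ a b, lvl a ≠ lvl b → (Matrix.of (fun a b : Fin m => if lvl a = lvl b then N a b else 0)) a b = 0 :=
    fun a b h => by rw [Matrix.of_apply, if_neg h]
  conv_lhs => rw [eq_diagPart_add_coupling lvl N hcut]
  refine trace_add_pow_mul_swap _ _ _ ?_ ?_ ?_ ?_ k
  · exact strict_mul_pow_diag_mul_strict_eq_zero lvl hlvl _ _ hD (fun a b => lvl b < lvl a) (fun a b h => h)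
      (fun a b h => by rw [Matrix.of_apply, if_neg h]) 
  · -- the up-entries: use the reversed labelling `1 - lvl`
    exact strict_mul_pow_diag_mul_strict_eq_zero (fun a => 1 - lvl a) (fun a => by omega) _ _
      (fun a b h => hD a b (fun h' => h (by rw [h']))) (fun a b => lvl a < lvl b)
      (fun a b h => by have := hlvl a; have := hlvl b; omega) (fun a b h => by rw [Matrix.of_apply, if_neg h])
  · exact fun j => trace_pow_diag_mul_offLevel_eq_zero lvl _ _ hD
      (fun a b h => by rw [Matrix.of_apply, if_neg (by rw [h]; exact lt_irrefl _)]) j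
  · exact fun j => trace_pow_diag_mul_offLevel_eq_zero lvl _ _ hD
      (fun a b h => by rw [Matrix.of_apply, if_neg (by rw [h]; exact lt_irrefl _)]) j

/-- Entries of `D^i·Ĉ·D^j` (level-preserving, coupling, level-preserving) go strictly DOWN in level. [folklore] -/
theorem pow_mul_coupling_mul_pow_apply_eq_zero (lvl : Fin m → ℕ) (D E : AffMat n m)
    (hD : ∀ a b, lvl a ≠ lvl b → D a b = 0) (hE : ∀ a b, ¬ lvl b < lvl a → E a b = 0) (i j : ℕ) (a b : Fin m)
    (hab : ¬ lvl b < lvl a) : (D ^ i * E * D ^ j) a b = 0 := by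
  rw [Matrix.mul_apply]
  refine Finset.sum_eq_zero fun d _ => ?_
  by_cases hdb : lvl d = lvl b
  · rw [Matrix.mul_apply]
    have hsum : ∑ c, (D ^ i) a c * E c d = 0 := by
      refine Finset.sum_eq_zero fun c _ => ?_
      by_cases hac : lvl a = lvl c
      · rw [hE c d (by rw [← hac, hdb]; exact hab), mul_zero]
      · rw [pow_apply_eq_zero_of_lvl_ne lvl D hD i a c hac, zero_mul]
    rw [hsum, zero_mul]
  · rw [pow_apply_eq_zero_of_lvl_ne lvl D hD j d b hdb, mul_zero]

/-- ★ **The same-level part of a nilpotent level-cut pencil is nilpotent**: `N^h = 0 ⟹ D^h = 0` (the block-diagonal part of the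
expansion `N^h = D^h + Σ D^i·Ĉ·D^{h−1−i}`; two levels). [folklore] -/
theorem diagPart_pow_eq_zero (lvl : Fin m → ℕ) (hlvl : ∀ a, lvl a ≤ 1) (N : AffMat n m)
    (hcut : ∀ a b, lvl a < lvl b → N a b = 0) {h : ℕ} (hnil : N ^ h = 0) :
    (Matrix.of (fun a b : Fin m => if lvl a = lvl b then N a b else 0)) ^ h = 0 := by
  have hD : ∀ a b, lvl a ≠ lvl b → (Matrix.of (fun a b : Fin m => if lvl a = lvl b then N a b else 0)) a b = 0 :=
    fun a b hab => by rw [Matrix.of_apply, if_neg hab]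
  have hE : ∀ a b, ¬ lvl b < lvl a → (Matrix.of (fun a b : Fin m => if lvl b < lvl a then N a b else 0)) a b = 0 :=
    fun a b hab => by rw [Matrix.of_apply, if_neg hab]
  have hexp := add_pow_eq_of_mul_pow_mul_eq_zero _ _
    (strict_mul_pow_diag_mul_strict_eq_zero lvl hlvl _ _ hD (fun a b => lvl b < lvl a) (fun a b h => h) hE) h
  rw [← eq_diagPart_add_coupling lvl N hcut, hnil] at hexp
  -- `D^h = -(sum)`, and the sum has no same-level or up entries while `D^h` has only same-level entries
  refine Matrix.ext fun a b => ?_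
  rw [Matrix.zero_apply]
  by_cases hab : lvl a = lvl b
  · have hentry := congrFun (congrFun hexp a) b
    rw [Matrix.zero_apply, Matrix.add_apply, Matrix.sum_apply,
      Finset.sum_eq_zero (fun i _ => pow_mul_coupling_mul_pow_apply_eq_zero lvl _ _ hD hE i (h - 1 - i) a b
        (by rw [hab]; exact lt_irrefl _)), add_zero] at hentry
    exact hentry.symm
  · exact pow_apply_eq_zero_of_lvl_ne lvl _ hD h a b hab

/-- ★ **The swapped pencil `D + M^cut` is nilpotent** (two levels; `N^m = 0`). [folklore] -/
theorem diagPart_add_cut_pow_eq_zero (lvl : Fin m → ℕ) (hlvl : ∀ a, lvl a ≤ 1) (N M : AffMat n m)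
    (hcut : ∀ a b, lvl a < lvl b → N a b = 0) (hNm : N ^ m = 0) :
    (Matrix.of (fun a b : Fin m => if lvl a = lvl b then N a b else 0) +
      Matrix.of (fun i j : Fin m => if lvl i < lvl j then M i j else 0)) ^ m = 0 := by
  have hD : ∀ a b, lvl a ≠ lvl b → (Matrix.of (fun a b : Fin m => if lvl a = lvl b then N a b else 0)) a b = 0 :=
    fun a b hab => by rw [Matrix.of_apply, if_neg hab]
  have hDm := diagPart_pow_eq_zero lvl hlvl N hcut hNm
  have hF := strict_mul_pow_diag_mul_strict_eq_zero (fun a => 1 - lvl a) (fun a => by omega) _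
    (Matrix.of (fun i j : Fin m => if lvl i < lvl j then M i j else 0))
    (fun a b h => hD a b (fun h' => h (by rw [h']))) (fun a b => lvl a < lvl b)
    (fun a b h => by have := hlvl a; have := hlvl b; omega) (fun a b h => by rw [Matrix.of_apply, if_neg h])
  refine pow_card_eq_zero_of_pow_eq_zero _ (h := m + m) ?_
  rw [add_pow_eq_of_mul_pow_mul_eq_zero _ _ hF (m + m), pow_add, hDm, Matrix.zero_mul, zero_add]
  refine Finset.sum_eq_zero fun i hi => ?_
  rw [Finset.mem_range] at hi
  rcases Nat.lt_or_ge i m with him | him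
  · obtain ⟨d, hd⟩ : ∃ d, m + m - 1 - i = m + d := ⟨m + m - 1 - i - m, by omega⟩
    rw [hd, pow_add, hDm, Matrix.zero_mul, Matrix.mul_zero]
  · obtain ⟨d, hd⟩ : ∃ d, i = m + d := ⟨i - m, by omega⟩
    rw [hd, pow_add, hDm, Matrix.zero_mul, Matrix.zero_mul, Matrix.zero_mul]

/-- The swapped pencil `D + M^cut` is a matrix of linear forms. [folklore] -/
theorem isHomogeneous_diagPart_add_cut (lvl : Fin m → ℕ) (N M : AffMat n m)
    (hN : ∀ i j, (N i j).IsHomogeneous 1) (hM : ∀ i j, (M i j).IsHomogeneous 1) (i j : Fin m) :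
    ((Matrix.of (fun a b : Fin m => if lvl a = lvl b then N a b else 0) +
      Matrix.of (fun i j : Fin m => if lvl i < lvl j then M i j else 0)) i j).IsHomogeneous 1 := by
  rw [Matrix.add_apply, Matrix.of_apply, Matrix.of_apply]
  refine IsHomogeneous.add ?_ ?_
  · split_ifs
    · exact hN i j
    · exact isHomogeneous_zero _ _ _
  · split_ifs
    · exact hM i j
    · exact isHomogeneous_zero _ _ _

/-- ★ **A rank-one COUPLING is cheap, in the ledger's language.**  Two-level level-cut pencil `N` (`N^m = 0`) whose coupling part
is `u vᵀ` (`u` constant, `v` linear), any numerator `M`, high constraints `tr(N^k·M^cut) = 0` for `k ≥ n`: then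
`rank Hess tr(N^{n−1}·M^cut)(z) ≤ 2(m+1)` at every point. [cite: MignonRessayre2004, Thm. 1.1 — via the tree; folklore] -/
theorem rank_hess0_cut_le_of_rankOne_coupling_lvl (hn : 2 ≤ n) (lvl : Fin m → ℕ) (hlvl : ∀ a, lvl a ≤ 1) (N M : AffMat n m)
    (hN : ∀ i j, (N i j).IsHomogeneous 1) (hM : ∀ i j, (M i j).IsHomogeneous 1) (hNm : N ^ m = 0)
    (hcut : ∀ a b, lvl a < lvl b → N a b = 0)
    (u : Fin m → ℂ) (v : Fin m → MvPolynomial (Fin n × Fin n) ℂ) (hv : ∀ j, (v j).IsHomogeneous 1)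
    (hC : Matrix.of (fun a b : Fin m => if lvl b < lvl a then N a b else 0) = vecMulVec (fun i => MvPolynomial.C (u i)) v)
    (hhigh : ∀ k, n ≤ k → (N ^ k * Matrix.of (fun i j : Fin m => if lvl i < lvl j then M i j else 0)).trace = 0)
    (z : Fin n × Fin n → ℂ) :
    (hess0 (transl z ((N ^ (n - 1) * Matrix.of (fun i j : Fin m => if lvl i < lvl j then M i j else 0)).trace))).rank ≤
      2 * (m + 1) := by
  rw [trace_pow_mul_cut_eq_swap lvl hlvl N M hcut (n - 1), hC]
  refine rank_hess0_trace_pow_vecMulVec_le hn _ (isHomogeneous_diagPart_add_cut lvl N M hN hM)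
    (diagPart_add_cut_pow_eq_zero lvl hlvl N M hcut hNm) u v hv (fun k hk => ?_) z
  rw [← hC, ← trace_pow_mul_cut_eq_swap lvl hlvl N M hcut k]
  exact hhigh k hk

/-- The transposed orientation (`u` linear, `v` constant). [cite: MignonRessayre2004, Thm. 1.1 — via the tree; folklore] -/
theorem rank_hess0_cut_le_of_rankOne_coupling_lvl' (hn : 2 ≤ n) (lvl : Fin m → ℕ) (hlvl : ∀ a, lvl a ≤ 1) (N M : AffMat n m)
    (hN : ∀ i j, (N i j).IsHomogeneous 1) (hM : ∀ i j, (M i j).IsHomogeneous 1) (hNm : N ^ m = 0)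
    (hcut : ∀ a b, lvl a < lvl b → N a b = 0)
    (u : Fin m → MvPolynomial (Fin n × Fin n) ℂ) (hu : ∀ i, (u i).IsHomogeneous 1) (v : Fin m → ℂ)
    (hC : Matrix.of (fun a b : Fin m => if lvl b < lvl a then N a b else 0) = vecMulVec u (fun j => MvPolynomial.C (v j)))
    (hhigh : ∀ k, n ≤ k → (N ^ k * Matrix.of (fun i j : Fin m => if lvl i < lvl j then M i j else 0)).trace = 0)
    (z : Fin n × Fin n → ℂ) :
    (hess0 (transl z ((N ^ (n - 1) * Matrix.of (fun i j : Fin m => if lvl i < lvl j then M i j else 0)).trace))).rank ≤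
      2 * (m + 1) := by
  rw [trace_pow_mul_cut_eq_swap lvl hlvl N M hcut (n - 1), hC]
  refine rank_hess0_trace_pow_vecMulVec_le' hn _ (isHomogeneous_diagPart_add_cut lvl N M hN hM)
    (diagPart_add_cut_pow_eq_zero lvl hlvl N M hcut hNm) u hu v (fun k hk => ?_) z
  rw [← hC, ← trace_pow_mul_cut_eq_swap lvl hlvl N M hcut k]
  exact hhigh k hk

/-- ★ **Ledger form: a two-level pencil with index-`n` classes and a rank-one coupling block obeys the 3/2 rung, whatever the
back-coupling.**  `(n² − 2(m+1))·n ≤ 2·Σ_p s_p²`. [cite: MignonRessayre2004, Thm. 1.1 — via the tree; folklore] -/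
theorem sq_sub_mul_le_of_levelCut_rankOneCoupling (hn : 2 ≤ n) (N M : AffMat n m)
    (hN : ∀ i j, (N i j).IsHomogeneous 1) (hM : ∀ i j, (M i j).IsHomogeneous 1) (hNm : N ^ m = 0)
    (hper : perPoly (Fin n) ℂ = (N ^ (n - 1) * M).trace)
    (hconstr : ∀ k, n ≤ k → (N ^ k * M).trace = 0)
    (lvl : Fin m → ℕ) (hlvl : ∀ a, lvl a ≤ 1) (hcut : ∀ a b, lvl a < lvl b → N a b = 0)
    (s : ℕ → ℕ) (e : ∀ p : ℕ, {i : Fin m // lvl i = p} ≃ Fin (s p))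
    (hindex : ∀ p ∈ Finset.univ.image lvl, (classPencil N (e p)) ^ n = 0)
    (u : Fin m → ℂ) (v : Fin m → MvPolynomial (Fin n × Fin n) ℂ) (hv : ∀ j, (v j).IsHomogeneous 1)
    (hC : Matrix.of (fun a b : Fin m => if lvl b < lvl a then N a b else 0) = vecMulVec (fun i => MvPolynomial.C (u i)) v) :
    (n ^ 2 - 2 * (m + 1)) * n ≤ 2 * ∑ p ∈ Finset.univ.image lvl, s p ^ 2 := by
  classical
  have h := sq_sub_rank_mul_le_of_levelCut hn N M hN hM hper lvl hcut s e (Finset.univ.image lvl)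
    (Finset.Subset.refl _) hindex
  have hempty : (Finset.univ.image lvl).filter (fun p => p ∉ Finset.univ.image lvl) = ∅ := by
    ext p
    simp only [Finset.mem_filter, Finset.notMem_empty, iff_false, not_and, not_not]
    exact fun hp => hp
  rw [hempty, Finset.sum_empty, zero_add] at h
  have hhigh : ∀ k, n ≤ k → (N ^ k * Matrix.of (fun i j : Fin m => if lvl i < lvl j then M i j else 0)).trace = 0 :=
    fun k hk => trace_pow_mul_cut_eq_zero_of_classIndex lvl N M hcut s e hindex k hk (hconstr k hk)
  have hrank := rank_hess0_cut_le_of_rankOne_coupling_lvl hn lvl hlvl N M hN hM hNm hcut u v hv hC hhigh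
    (fun w : Fin n × Fin n => if w.1 = (1 : Equiv.Perm (Fin n)) w.2 then (1 : ℂ) else 0)
  exact (Nat.mul_le_mul_right _ (by omega)).trans h

/-- ★ **A rank-`r` COUPLING under piecewise high constraints costs `O(r·m)`.**  Two-level level-cut `N` (`N^m = 0`) whose
coupling part is `U·V` (`U` constant `m × r`, `V` linear `r × m`); if in the swapped reading each rank-one piece satisfies the high
constraints, `(V·(D + M^cut)^k·U)_{ii} = 0` for `k ≥ n`, then `rank Hess tr(N^{n−1}·M^cut)(z) ≤ r·2(m+1)` at every point.
(✓ `rank_hess0_trace_pow_constMul_le` after ✓ `trace_pow_mul_cut_eq_swap`.) [cite: MignonRessayre2004, Thm. 1.1 — via the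
tree; folklore] -/
theorem rank_hess0_cut_le_of_lowRank_coupling_lvl {r : ℕ} (hn : 2 ≤ n) (lvl : Fin m → ℕ) (hlvl : ∀ a, lvl a ≤ 1)
    (N M : AffMat n m) (hN : ∀ i j, (N i j).IsHomogeneous 1) (hM : ∀ i j, (M i j).IsHomogeneous 1) (hNm : N ^ m = 0)
    (hcut : ∀ a b, lvl a < lvl b → N a b = 0)
    (U : Matrix (Fin m) (Fin r) ℂ) (V : Matrix (Fin r) (Fin m) (MvPolynomial (Fin n × Fin n) ℂ))
    (hV : ∀ i j, (V i j).IsHomogeneous 1)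
    (hC : Matrix.of (fun a b : Fin m => if lvl b < lvl a then N a b else 0) =
      U.map (MvPolynomial.C : ℂ →+* MvPolynomial (Fin n × Fin n) ℂ) * V)
    (hhigh : ∀ k, n ≤ k → ∀ i : Fin r,
      (V * (Matrix.of (fun a b : Fin m => if lvl a = lvl b then N a b else 0) +
        Matrix.of (fun i j : Fin m => if lvl i < lvl j then M i j else 0)) ^ k *
        U.map (MvPolynomial.C : ℂ →+* MvPolynomial (Fin n × Fin n) ℂ)) i i = 0)
    (z : Fin n × Fin n → ℂ) :
    (hess0 (transl z ((N ^ (n - 1) * Matrix.of (fun i j : Fin m => if lvl i < lvl j then M i j else 0)).trace))).rank ≤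
      r * (2 * (m + 1)) := by
  rw [trace_pow_mul_cut_eq_swap lvl hlvl N M hcut (n - 1), hC]
  exact rank_hess0_trace_pow_constMul_le hn _ (isHomogeneous_diagPart_add_cut lvl N M hN hM)
    (diagPart_add_cut_pow_eq_zero lvl hlvl N M hcut hNm) U V hV hhigh z

end TwoLevel

end Summit.ValiantsHypothesis.ValiantsHypothesis.Theorems.GrenetZeonTwoDimCoefficients.ScalingClosure

end
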